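import Literature.Geometry.Riemannian.ChartMeasureComparison
import Literature.Geometry.Riemannian.PerelmanEntropy
import HarnessLib

/-!
# Small geodesic balls have almost-Euclidean volume: a lower bound with a universal constant

For a smooth Riemannian metric `g` on a manifold `M` modelled on `ℝᵐ` and a point `p ∈ M` we
prove (`exists_riemVolume_ball_ge_small`, closed manifolds; the local form
`volume_ball_mul_pow_le_riemVolume_setOf_edist_lt` needs no compactness)

  `c(m) ρᵐ ≤ Vol_g B_g(p, ρ)` for all `0 < ρ ≤ ρ₀(g, p)`,

with a constant `c(m) > 0` depending ONLY on the dimension — here `c(m) = |B₁ᵐ| / 4ᵐ`, `|B₁ᵐ|`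
the Lebesgue measure of the Euclidean unit ball — i.e. `liminf_{ρ → 0} ρ⁻ᵐ Vol_g B_g(p, ρ) ≥ c(m)`
at every point of every Riemannian `m`-manifold (the sharp statement being
`lim_{ρ → 0} ρ⁻ᵐ Vol_g B_g(p, ρ) = |B₁ᵐ|`, Chavel 2006, §III.3; the non-sharp constant is what is
consumed downstream). This is the "small scales" input of the descent argument in the proof of the
lower volume bound `|B(x, t, r)|_t ≥ c exp(𝒩_{x,t}(r²)) rⁿ` of Bamler 2020a, Thm. 6.1: if the bound
failed at scale `r` with a small constant it would fail at `r/2, r/4, …`, contradicting the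
almost-Euclidean volume of small balls. Contrast the tree's
`exists_mul_pow_le_riemVolume_real_setOf_edist_lt` / `PseudoRiemannianMetric.exists_mul_pow_le_vol_ball`
(`CanonicalNeighbourhoodsProofs.lean`, `VolumeSmallBalls.lean`), whose constant depends on the
metric through un-normalised bi-Lipschitz constants of a chart.

## Proof

Linearise the chart `φ = extChartAt I p` at `p`: there is a linear map `A` of `ℝᵐ` with
`‖A w‖ = |D(φ⁻¹)_{φ p} w|_g` (`exists_norm_eq_norm_symmL` of `VolumeChartFormula.lean`), and then
`A ∘ φ` is `2`-bi-Lipschitz for `d_g` on a neighbourhood of `p`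
(`exists_nhds_riemannianEDist_le_and_edist_le`: continuity of the metric in the chart,
Burago–Burago–Ivanov 2001, §5.1), whence `μH[m](A φ s) ≤ 2ᵐ μH[m](s)` for `s` near `p`
(`exists_nhds_hausdorffMeasure_le_and_le`; Federer 1969, §2.10.11). For small `ρ` the distance
ball `B_g(p, ρ)` lies in that neighbourhood and `A φ (B_g(p, ρ))` contains the Euclidean ball
`B(A φ p, ρ/2)`, of Lebesgue measure `|B₁ᵐ| (ρ/2)ᵐ`. As `Vol_g = μHE[m]` is the
Euclidean-normalised Hausdorff measure of `d_g` and `μHE[m]` is Lebesgue measure on `ℝᵐ` (same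
normalising factor), `2ᵐ Vol_g B_g(p, ρ) ≥ |B₁ᵐ| (ρ/2)ᵐ`.

## References

* R. H. Bamler, *Entropy and heat kernel bounds on a Ricci flow background*, arXiv:2008.07093
  (2020), §6, proof of Thm. 6.1 (the contradiction "for small `r` the ball is almost Euclidean").
  [Bamler2020Entropy]
* I. Chavel, *Riemannian Geometry: A Modern Introduction*, 2nd ed., CUP 2006, §III.3 (volume of
  small metric disks). [Chavel2006]
* D. Burago, Yu. Burago, S. Ivanov, *A course in metric geometry*, AMS 2001, §5.1 (charts are
  locally bi-Lipschitz with constants close to `1` for the length metric).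
* H. Federer, *Geometric Measure Theory*, Springer 1969, §2.10.11 (Lipschitz maps and `H^m`),
  §3.2.46. [Federer1969]
-/

noncomputable section

open Set Filter Function MeasureTheory Measure Module Metric Manifold Bundle
open scoped Manifold ContDiff Topology ENNReal NNReal

namespace Literature.Geometry.Riemannian

open Lorentzian Lorentzian.PseudoRiemannianMetric

variable {m : ℕ} {H : Type*} [TopologicalSpace H]
  {I : ModelWithCorners ℝ (EuclideanSpace ℝ (Fin m)) H} [I.Boundaryless]

set_option backward.isDefEq.respectTransparency false in
/-- **Small distance balls have almost-Euclidean volume, local `ℝ≥0∞` form.** For a smooth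
Riemannian `g` on a (regular, boundaryless) manifold modelled on `ℝᵐ` and `p ∈ M` there is
`ρ₀ > 0` such that `|B₁ᵐ| (ρ/2)ᵐ ≤ 2ᵐ Vol_g {w | d_g(p, w) < ρ}` for all `0 < ρ ≤ ρ₀`, where
`|B₁ᵐ|` is the Lebesgue measure of the unit ball of `ℝᵐ` (a linearised chart at `p` is
`2`-bi-Lipschitz near `p`; Lipschitz maps expand `μH[m]` by at most `Lipᵐ`, Federer 1969,
§2.10.11; `lim_{ρ→0} ρ⁻ᵐ V(p; ρ) = |B₁ᵐ|`, Chavel 2006, §III.3). [cite: Chavel2006, §III.3] -/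
theorem volume_ball_mul_pow_le_riemVolume_setOf_edist_lt {M : Type*} [TopologicalSpace M]
    [ChartedSpace H M] [IsManifold I ∞ M] [T3Space M] [MeasurableSpace M] [BorelSpace M]
    (g : PseudoRiemannianMetric I ∞ (EuclideanSpace ℝ (Fin m)) (TangentSpace I : M → Type _))
    (hg : g.IsRiemannian) (p : M) :
    ∃ ρ₀ : ℝ, 0 < ρ₀ ∧ ∀ ρ ∈ Ioc 0 ρ₀,
      volume (ball (0 : EuclideanSpace ℝ (Fin m)) 1) * ENNReal.ofReal ((ρ / 2) ^ m) ≤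
        2 ^ m * g.riemVolume {w | g.edist hg p w < ENNReal.ofReal ρ} := by
  letI := g.riemannianBundle hg
  haveI := g.isContinuousRiemannianBundle hg
  letI : EMetricSpace M := EMetricSpace.ofRiemannianMetric I M
  haveI : IsRiemannianManifold I M := ⟨fun _ _ ↦ rfl⟩
  set φ := extChartAt I p with hφ
  have hp : p ∈ (chartAt H p).source := mem_chart_source H p
  -- a chart linearization `A` at `p`; `A ∘ φ` is `2`-bi-Lipschitz near `p`
  obtain ⟨A, hA⟩ := exists_norm_eq_norm_symmL (I := I) p p
  obtain ⟨Ae, hAe⟩ := exists_continuousLinearEquiv_of_norm_eq_norm_symmL (I := I) p p hp hA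
  have h12 : (1 : ℝ≥0) < 2 := one_lt_two
  obtain ⟨U₁, hU₁, -, hdle, -⟩ :=
    exists_nhds_riemannianEDist_le_and_edist_le (I := I) p p hp hA h12
  obtain ⟨U₂, hU₂, -, hH⟩ :=
    exists_nhds_hausdorffMeasure_le_and_le (I := I) p p hp hA h12 (d := (m : ℝ)) m.cast_nonneg
  -- `A φ (U₁ ∩ U₂)` is a neighbourhood of `A (φ p)`: it contains a ball `B(A φ p, ε)`
  have hAU : A '' (φ '' (U₁ ∩ U₂)) ∈ 𝓝 (A (φ p)) := by
    have h1 : φ '' (U₁ ∩ U₂) ∈ 𝓝 (φ p) :=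
      extChartAt_image_nhds_mem_nhds_of_boundaryless (inter_mem hU₁ hU₂)
    have h2 : A '' (φ '' (U₁ ∩ U₂)) = Ae '' (φ '' (U₁ ∩ U₂)) :=
      image_congr fun w _ ↦ (hAe w).symm
    rw [h2, ← hAe]
    exact Ae.isOpenMap.image_mem_nhds h1
  obtain ⟨ε, hε, hεU⟩ := Metric.mem_nhds_iff.1 hAU
  -- small distance balls lie in `U₁ ∩ U₂`
  obtain ⟨r₀, hr₀, hr₀U⟩ := setOf_riemannianEDist_lt_subset_nhds I (inter_mem hU₁ hU₂)
  refine ⟨min ε r₀, lt_min hε (NNReal.coe_pos.2 hr₀), fun ρ hρ ↦ ?_⟩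
  have hρ0 : 0 < ρ := hρ.1
  have hρε : ρ ≤ ε := hρ.2.trans (min_le_left _ _)
  have hρr : ρ ≤ r₀ := hρ.2.trans (min_le_right _ _)
  set S := {w | g.edist hg p w < ENNReal.ofReal ρ} with hS
  have hSU : S ⊆ U₁ ∩ U₂ := by
    refine Subset.trans (fun w hw ↦ ?_) hr₀U
    rw [hS, mem_setOf_eq] at hw
    rw [mem_setOf_eq]
    calc riemannianEDist I p w = g.edist hg p w := rfl
      _ < ENNReal.ofReal ρ := hw
      _ ≤ (r₀ : ℝ≥0∞) := by
          rw [← ENNReal.ofReal_coe_nnreal]; exact ENNReal.ofReal_le_ofReal hρr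
  -- the Euclidean ball `B(A φ p, ρ/2)` is inside `A φ S`
  have hball : ball (A (φ p)) (ρ / 2) ⊆ A '' (φ '' S) := by
    intro z hz
    have hzε : z ∈ ball (A (φ p)) ε := ball_subset_ball (by linarith) hz
    obtain ⟨_, ⟨q, hq, rfl⟩, rfl⟩ := hεU hzε
    refine ⟨φ q, ⟨q, ?_, rfl⟩, rfl⟩
    rw [hS, mem_setOf_eq]
    have h1 : riemannianEDist I p q ≤ (2 : ℝ≥0) * edist (A (φ p)) (A (φ q)) :=
      hdle p (mem_of_mem_nhds hU₁) q hq.1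
    have h2 : edist (A (φ p)) (A (φ q)) < ENNReal.ofReal (ρ / 2) := by
      rw [PseudoEMetricSpace.edist_comm, edist_lt_ofReal]; exact hz
    calc g.edist hg p q = riemannianEDist I p q := rfl
      _ ≤ (2 : ℝ≥0) * edist (A (φ p)) (A (φ q)) := h1
      _ < (2 : ℝ≥0) * ENNReal.ofReal (ρ / 2) :=
          ENNReal.mul_lt_mul_right (by norm_num) ENNReal.coe_ne_top h2
      _ = ENNReal.ofReal ρ := by
          rw [← ENNReal.ofReal_coe_nnreal, ← ENNReal.ofReal_mul NNReal.zero_le_coe]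
          congr 1
          push_cast
          ring
  -- Hausdorff measures: `μH[m] (A φ S) ≤ 2ᵐ μH[m] S`
  have hHS : μH[m] (A '' (φ '' S)) ≤ (2 : ℝ≥0∞) ^ m * μH[m] S := by
    have h := (hH S (hSU.trans inter_subset_right)).2
    rwa [ENNReal.rpow_natCast, ENNReal.coe_ofNat] at h
  -- the common normalisation `σ` of `Vol_g = μHE[m]` (on `M`) and of Lebesgue `= μHE[m]` (on `ℝᵐ`)
  set σ : ℝ≥0 := addHaarScalarFactor (volume : Measure (EuclideanSpace ℝ (Fin m)))
    (μH[m] : Measure (EuclideanSpace ℝ (Fin m))) with hσ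
  have hvolM : g.riemVolume S = (σ : ℝ≥0∞) * μH[m] S := by
    rw [PseudoRiemannianMetric.riemVolume_eq hg]
    change riemannianVolume (g.toContMDiffRiemannianMetric hg)
      (finrank ℝ (EuclideanSpace ℝ (Fin m))) S = _
    rw [finrank_euclideanSpace_fin]
    change (μHE[m] : Measure M) S = _
    rw [Measure.euclideanHausdorffMeasure_def, Measure.smul_apply, ENNReal.smul_def, smul_eq_mul]
  have hvolF : ∀ s : Set (EuclideanSpace ℝ (Fin m)), volume s = (σ : ℝ≥0∞) * μH[m] s := by
    intro s
    rw [← EuclideanSpace.euclideanHausdorffMeasure_eq_volume m,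
      Measure.euclideanHausdorffMeasure_def, Measure.smul_apply, ENNReal.smul_def, smul_eq_mul]
  have hscale : volume (ball (A (φ p)) (ρ / 2)) =
      ENNReal.ofReal ((ρ / 2) ^ m) * volume (ball (0 : EuclideanSpace ℝ (Fin m)) 1) := by
    rw [Measure.addHaar_ball_of_pos volume _ (half_pos hρ0), finrank_euclideanSpace_fin]
  calc volume (ball (0 : EuclideanSpace ℝ (Fin m)) 1) * ENNReal.ofReal ((ρ / 2) ^ m)
      = volume (ball (A (φ p)) (ρ / 2)) := by rw [hscale, mul_comm]
    _ = (σ : ℝ≥0∞) * μH[m] (ball (A (φ p)) (ρ / 2)) := hvolF _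
    _ ≤ (σ : ℝ≥0∞) * μH[m] (A '' (φ '' S)) := by gcongr
    _ ≤ (σ : ℝ≥0∞) * ((2 : ℝ≥0∞) ^ m * μH[m] S) := by gcongr
    _ = 2 ^ m * g.riemVolume S := by rw [hvolM]; ring

/-- **Small balls have almost-Euclidean volume, with a universal constant** (the "small scales"
input of the descent argument of Bamler 2020a, proof of Thm. 6.1; Chavel 2006, §III.3 for
`lim_{ρ→0} ρ⁻ᵐ V(p; ρ) = |B₁ᵐ|`): for every dimension `m` there is `c = c(m) > 0` (here
`|B₁ᵐ| / 4ᵐ`, `|B₁ᵐ|` the Lebesgue measure of the Euclidean unit ball) such that for EVERY smooth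
Riemannian metric `g` on a closed `m`-manifold and every point `p` there is `ρ₀ = ρ₀(g, p) > 0`
with `c ρᵐ ≤ Vol_g {w | d_g(p, w) < ρ}` for all `0 < ρ ≤ ρ₀` — the constant does not depend on
the metric. [cite: Bamler2020Entropy, §6, proof of Thm. 6.1] [cite: Chavel2006, §III.3] -/
theorem exists_riemVolume_ball_ge_small (m : ℕ) {H : Type*} [TopologicalSpace H]
    {I : ModelWithCorners ℝ (EuclideanSpace ℝ (Fin m)) H} [I.Boundaryless] :
    ∃ c : ℝ, 0 < c ∧ ∀ {M : Type*} [TopologicalSpace M] [ChartedSpace H M] [IsManifold I ∞ M]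
      [T2Space M] [CompactSpace M] [SecondCountableTopology M] [MeasurableSpace M] [BorelSpace M]
      [T3Space M]
      (g : PseudoRiemannianMetric I ∞ (EuclideanSpace ℝ (Fin m)) (TangentSpace I : M → Type _))
      (hg : g.IsRiemannian) (p : M),
      ∃ ρ₀ : ℝ, 0 < ρ₀ ∧ ∀ ρ ∈ Ioc 0 ρ₀,
        c * ρ ^ m ≤ g.riemVolume.real {w | g.edist hg p w < ENNReal.ofReal ρ} := by
  set K : ℝ≥0∞ := volume (ball (0 : EuclideanSpace ℝ (Fin m)) 1) with hK
  have hK0 : K ≠ 0 := (measure_ball_pos volume _ one_pos).ne'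
  have hKt : K ≠ ⊤ := measure_ball_lt_top.ne
  refine ⟨K.toReal / 4 ^ m, div_pos (ENNReal.toReal_pos hK0 hKt) (pow_pos four_pos m), ?_⟩
  intro M _ _ _ _ _ _ _ _ _ g hg p
  obtain ⟨ρ₀, hρ₀, h⟩ := volume_ball_mul_pow_le_riemVolume_setOf_edist_lt (I := I) g hg p
  refine ⟨ρ₀, hρ₀, fun ρ hρ ↦ ?_⟩
  have hρ0 : 0 < ρ := hρ.1
  set S := {w | g.edist hg p w < ENNReal.ofReal ρ} with hS
  have hfin : g.riemVolume S ≠ ⊤ :=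
    (lt_of_le_of_lt (measure_mono (subset_univ _)) g.riemVolume_univ_lt_top).ne
  have h2 : (2 : ℝ≥0∞) ^ m * g.riemVolume S ≠ ⊤ :=
    ENNReal.mul_ne_top (ENNReal.pow_ne_top ENNReal.ofNat_ne_top) hfin
  have hreal := ENNReal.toReal_mono h2 (h ρ hρ)
  rw [ENNReal.toReal_mul, ENNReal.toReal_ofReal (by positivity), ENNReal.toReal_mul,
    ENNReal.toReal_pow, ENNReal.toReal_ofNat] at hreal
  rw [measureReal_def]
  have h4 : (4 : ℝ) ^ m = 2 ^ m * 2 ^ m := by rw [← mul_pow]; norm_num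
  have h2m : (0 : ℝ) < 2 ^ m := pow_pos two_pos m
  calc K.toReal / 4 ^ m * ρ ^ m = K.toReal * (ρ / 2) ^ m / 2 ^ m := by
        rw [h4, div_pow]; field_simp
    _ ≤ 2 ^ m * (g.riemVolume S).toReal / 2 ^ m := by gcongr
    _ = (g.riemVolume S).toReal := by field_simp

end Literature.Geometry.Riemannian

end
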